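import Summits.Ventures.PercRepro.ProfileTwoRowSelf

/-!
# PercRepro — THE HALL FORM (C-033, `H⁺`) OF THE ROW `q = 2`, MODULO ITS BASE CASE
(p10, gen 4; paper `proofs/P10-HALLROW.md`; S5 §2.5 of `proofs/SUBCLAIM-S5-p10.md`)

`(H⁺_{2,u})(M)` (`Profile.HallIneq M 2 u`): for every family `𝒜` of rank-`2` sets,
`Σ_{B ∈ 𝒜} price(B) ≤ #{S : ρ(S) = u, S ⊇ some B ∈ 𝒜}`.

On a simple matroid split `𝒜` into its pairs `𝒜_I` and its fat members `𝒜_F` (≥ 3 collinear points).  An independent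
`u`-set contains no fat member, so the shadow of `𝒜` contains the disjoint union of the INDEPENDENT shadow of `𝒜_I`
(`indepShadow`) and the (dependent) shadow of `𝒜_F` (`fatShadow`).  The fat members are paid per member by the
injection `(B, Y) ↦ B ∪ Y` of ProfileTwoFat (`hall_fat2`, the family version of Theorem B).  The pairs are paid by the
AVERAGED DELETION INDUCTION of ProfileTwoAverage, member by member (`hallIndep2_of_base`): the per-pair inequality
`perPair` is per member, and the independent shadow obeys `Σ_z #∂ᴵ_{M∖z}(𝒜∖z) = (|E| − u) · #∂ᴵ_M(𝒜)`.  The induction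
needs its BASE CASE on `u + 2` elements, `HallBase u` — Hall's condition for «disjointness» on the pairs with independent
complement (paper §5: an abstract Hall lemma plus eight finite configurations) — which is NOT proved here: it is the
hypothesis of every theorem below.  With night-3's single-row reduction `hallIneq_row_of_simple` the row follows for
every finite matroid, modulo the same base.

* `indepShadow`, `fatShadow` — the two halves of the shadow of a family on a simple matroid;
* `sum_card_filter_mem`, `sum_card_indepShadow_delete_add` — the deletion average of the independent shadow;
* `hall_avg_step` — the averaged deletion step for a family of pairs;
* `HallBase` — the base case on `u + 2` elements (hypothesis);
* **`hallIndep2_of_base`** — the independent half for every family of pairs on every simple matroid, modulo the base;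
* **`hall_fat2`** — the fat half for every family of fat members;
* `card_indepShadow_add_card_fatShadow_le`, `sum_price_split`, `choose_mul_sum_price` — the split of a family;
* **`hallIneq_two_of_simple_of_base`**, **`hallIneq_two_all_of_base`** — `(H⁺_{2,u})` on every simple / every finite
  matroid, modulo the base.
-/

open scoped Matroid

namespace PercRepro.Cogirth

open Finset ThmH Skew Shadow Profile

variable {α : Type} [DecidableEq α] {M : Matroid α} [M.Finite]

/-! ### The two halves of the shadow -/

open Classical in
/-- The INDEPENDENT shadow of a family at level `u`: the independent `u`-sets containing a member. -/
noncomputable def indepShadow (M : Matroid α) [M.Finite] (u : ℕ) (𝒜 : Finset (Finset α)) :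
    Finset (Finset α) :=
  (indepSets M u).filter (fun S => ∃ B ∈ 𝒜, B ⊆ S)

open Classical in
/-- The DEPENDENT shadow of a family at level `u`: the dependent rank-`u` sets containing a member. -/
noncomputable def fatShadow (M : Matroid α) [M.Finite] (u : ℕ) (𝒜 : Finset (Finset α)) :
    Finset (Finset α) :=
  (depU M u).filter (fun S => ∃ B ∈ 𝒜, B ⊆ S)

open Classical in
/-- Membership in the independent shadow. -/
theorem mem_indepShadow {u : ℕ} {𝒜 : Finset (Finset α)} {S : Finset α} :
    S ∈ indepShadow M u 𝒜 ↔ S ∈ indepSets M u ∧ ∃ B ∈ 𝒜, B ⊆ S := by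
  unfold indepShadow
  rw [mem_filter]

open Classical in
/-- Membership in the dependent shadow. -/
theorem mem_fatShadow {u : ℕ} {𝒜 : Finset (Finset α)} {S : Finset α} :
    S ∈ fatShadow M u 𝒜 ↔ S ∈ depU M u ∧ ∃ B ∈ 𝒜, B ⊆ S := by
  unfold fatShadow
  rw [mem_filter]

/-! ### The deletion average of the independent shadow -/

/-- `Σ_{z ∈ E} #{S ∈ 𝒮 : z ∈ S} = u · #𝒮` for a family `𝒮` of independent `u`-sets. -/
theorem sum_card_filter_mem {u : ℕ} {𝒮 : Finset (Finset α)} (h𝒮 : 𝒮 ⊆ indepSets M u) :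
    ∑ z ∈ gr M, (𝒮.filter (fun S => z ∈ S)).card = u * 𝒮.card := by
  have h : ∀ (z : α) (S : Finset α), z ∈ gr M ∧ S ∈ 𝒮.filter (fun S => z ∈ S) ↔ z ∈ S ∧ S ∈ 𝒮 := by
    intro z S
    rw [mem_filter]
    constructor
    · rintro ⟨_, hS, hz⟩
      exact ⟨hz, hS⟩
    · rintro ⟨hz, hS⟩
      exact ⟨(mem_indepSets.1 (h𝒮 hS)).1 hz, hS, hz⟩
  calc ∑ z ∈ gr M, (𝒮.filter (fun S => z ∈ S)).card
      = ∑ z ∈ gr M, ∑ S ∈ 𝒮.filter (fun S => z ∈ S), 1 := by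
        simp only [card_eq_sum_ones]
    _ = ∑ S ∈ 𝒮, ∑ z ∈ S, 1 := sum_comm' h
    _ = ∑ S ∈ 𝒮, u := by
        apply sum_congr rfl
        intro S hS
        rw [← card_eq_sum_ones, (mem_indepSets.1 (h𝒮 hS)).2.1]
    _ = u * 𝒮.card := by rw [sum_const, smul_eq_mul, mul_comm]

/-- The independent shadow of `M ∖ z` of the members avoiding `z` is the part of the independent shadow of `M`
avoiding `z`. -/
theorem indepShadow_delete_eq_filter (z : α) (u : ℕ) (𝒜 : Finset (Finset α)) :
    indepShadow (M ＼ ({z} : Set α)) u (𝒜.filter (fun B => z ∉ B)) =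
      (indepShadow M u 𝒜).filter (fun S => z ∉ S) := by
  ext S
  rw [mem_indepShadow, mem_filter, mem_indepShadow, indepSets_delete_eq_filter, mem_filter]
  constructor
  · rintro ⟨⟨hS, hz⟩, B, hB, hBS⟩
    rw [mem_filter] at hB
    exact ⟨⟨hS, B, hB.1, hBS⟩, hz⟩
  · rintro ⟨⟨hS, B, hB, hBS⟩, hz⟩
    refine ⟨⟨hS, hz⟩, B, ?_, hBS⟩
    rw [mem_filter]
    exact ⟨hB, fun h => hz (hBS h)⟩

/-- `Σ_{z ∈ E} #∂ᴵ_{M ∖ z}(𝒜 ∖ z) + u · #∂ᴵ_M(𝒜) = |E| · #∂ᴵ_M(𝒜)`. -/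
theorem sum_card_indepShadow_delete_add (u : ℕ) (𝒜 : Finset (Finset α)) :
    ∑ z ∈ gr M, (indepShadow (M ＼ ({z} : Set α)) u (𝒜.filter (fun B => z ∉ B))).card +
      u * (indepShadow M u 𝒜).card = (gr M).card * (indepShadow M u 𝒜).card := by
  have hsub : indepShadow M u 𝒜 ⊆ indepSets M u := fun S hS => (mem_indepShadow.1 hS).1
  calc ∑ z ∈ gr M, (indepShadow (M ＼ ({z} : Set α)) u (𝒜.filter (fun B => z ∉ B))).card +
        u * (indepShadow M u 𝒜).card
      = ∑ z ∈ gr M, (((indepShadow M u 𝒜).filter (fun S => z ∉ S)).card +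
          ((indepShadow M u 𝒜).filter (fun S => z ∈ S)).card) := by
        rw [sum_add_distrib, sum_card_filter_mem hsub]
        congr 1
        apply sum_congr rfl
        intro z _
        rw [indepShadow_delete_eq_filter]
    _ = ∑ z ∈ gr M, (indepShadow M u 𝒜).card := by
        apply sum_congr rfl
        intro z _
        rw [add_comm]
        exact card_filter_add_card_filter_not (s := indepShadow M u 𝒜) (fun S => z ∈ S)
    _ = (gr M).card * (indepShadow M u 𝒜).card := by rw [sum_const, smul_eq_mul]

/-! ### The averaged deletion step for a family of pairs -/

/-- **The averaged deletion step for a family of pairs**: on a simple matroid with `≥ u + 3` elements, `u ≥ 3`,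
`(|E| − u) · Σ_{B ∈ 𝒜} demand_M(B) ≤ Σ_{z ∈ E} Σ_{B ∈ 𝒜, z ∉ B} demand_{M ∖ z}(B)`. -/
theorem hall_avg_step (hs : Simple' M) {u : ℕ} (hu : 3 ≤ u) (hn : u + 3 ≤ (gr M).card)
    {𝒜 : Finset (Finset α)} (h𝒜 : 𝒜 ⊆ indepSets M 2) :
    ((gr M).card - u) * ∑ B ∈ 𝒜, demand M 2 u B ≤
      ∑ z ∈ gr M, ∑ B ∈ 𝒜.filter (fun B => z ∉ B), demand (M ＼ ({z} : Set α)) 2 u B := by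
  rw [mul_sum]
  calc ∑ B ∈ 𝒜, ((gr M).card - u) * demand M 2 u B
      ≤ ∑ B ∈ 𝒜, ∑ z ∈ gr M \ B, demand (M ＼ ({z} : Set α)) 2 u B :=
        sum_le_sum (fun B hB => perPair hs hu hn (h𝒜 hB))
    _ = ∑ z ∈ gr M, ∑ B ∈ 𝒜.filter (fun B => z ∉ B), demand (M ＼ ({z} : Set α)) 2 u B := by
        apply sum_comm'
        intro B z
        rw [mem_sdiff, mem_filter]
        tauto

/-! ### The base case (hypothesis) and the induction -/

/-- **The base case of the Hall induction** on `u + 2` elements: for every simple matroid on `u + 2` elements and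
every family `𝒜` of pairs, `Σ_{B ∈ 𝒜} demand(B) ≤ C(u,2) · #∂ᴵ_u(𝒜)` — Hall's condition for «disjointness» on the
pairs with independent complement (paper P10-HALLROW.md §5, Lemma (KL)). -/
def HallBase (α : Type) [DecidableEq α] (u : ℕ) : Prop :=
  ∀ (N : Matroid α) [N.Finite], Simple' N → (gr N).card = u + 2 →
    ∀ 𝒜 ⊆ indepSets N 2, ∑ B ∈ 𝒜, demand N 2 u B ≤ u.choose 2 * (indepShadow N u 𝒜).card

/-- A member avoiding `z` is a pair of `M ∖ z`. -/
theorem filter_subset_indepSets_delete {𝒜 : Finset (Finset α)} (h𝒜 : 𝒜 ⊆ indepSets M 2) (z : α) :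
    𝒜.filter (fun B => z ∉ B) ⊆ indepSets (M ＼ ({z} : Set α)) 2 := by
  intro B hB
  rw [mem_filter] at hB
  rw [indepSets_delete_eq_filter, mem_filter]
  exact ⟨h𝒜 hB.1, hB.2⟩

/-- **The independent half of `(H⁺_{2,u})` for every family of pairs on every simple matroid, modulo the base
case** — strong induction on `|E|`: no demand on `≤ u + 1` elements, the base on `u + 2`, the averaged deletion
step above. -/
theorem hallIndep2_of_base_aux {u : ℕ} (hu : 3 ≤ u) (hbase : HallBase α u) :
    ∀ (n : ℕ) (M : Matroid α) [M.Finite], (gr M).card = n → Simple' M →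
      ∀ 𝒜 ⊆ indepSets M 2, ∑ B ∈ 𝒜, demand M 2 u B ≤ u.choose 2 * (indepShadow M u 𝒜).card := by
  intro n
  induction n using Nat.strong_induction_on with
  | _ n ih =>
    intro M _ hn hs 𝒜 h𝒜
    rcases Nat.lt_or_ge n (u + 2) with hsmall | hbig
    · rw [Finset.sum_eq_zero (fun B hB => demand_eq_zero_of_card_le (by omega) (by omega) (h𝒜 hB))]
      exact Nat.zero_le _
    rcases Nat.eq_or_lt_of_le hbig with heq | hgt
    · exact hbase M hs (by omega) 𝒜 h𝒜
    have hn3 : u + 3 ≤ (gr M).card := by omega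
    have hstep := hall_avg_step hs hu hn3 h𝒜
    have hih : ∀ z ∈ gr M, ∑ B ∈ 𝒜.filter (fun B => z ∉ B), demand (M ＼ ({z} : Set α)) 2 u B ≤
        u.choose 2 * (indepShadow (M ＼ ({z} : Set α)) u (𝒜.filter (fun B => z ∉ B))).card := by
      intro z hz
      have hcard : (gr (M ＼ ({z} : Set α))).card = n - 1 := by
        rw [gr_delete', card_erase_of_mem hz, hn]
      exact ih (n - 1) (by omega) (M ＼ ({z} : Set α)) hcard (simple'_delete hs z) _
        (filter_subset_indepSets_delete h𝒜 z)
    have hsum := sum_le_sum hih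
    rw [← mul_sum] at hsum
    have hid := sum_card_indepShadow_delete_add (M := M) u 𝒜
    have hkey : ((gr M).card - u) * ∑ B ∈ 𝒜, demand M 2 u B ≤
        ((gr M).card - u) * (u.choose 2 * (indepShadow M u 𝒜).card) := by
      calc ((gr M).card - u) * ∑ B ∈ 𝒜, demand M 2 u B
          ≤ ∑ z ∈ gr M, ∑ B ∈ 𝒜.filter (fun B => z ∉ B), demand (M ＼ ({z} : Set α)) 2 u B := hstep
        _ ≤ u.choose 2 * ∑ z ∈ gr M,
              (indepShadow (M ＼ ({z} : Set α)) u (𝒜.filter (fun B => z ∉ B))).card := hsum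
        _ = u.choose 2 * (((gr M).card - u) * (indepShadow M u 𝒜).card) := by
            rw [Nat.sub_mul, ← hid, Nat.add_sub_cancel]
        _ = ((gr M).card - u) * (u.choose 2 * (indepShadow M u 𝒜).card) := by ring
    exact Nat.le_of_mul_le_mul_left hkey (by omega)

/-- **The independent half, one-matroid form**: for every family `𝒜` of pairs of a simple matroid and every `u ≥ 3`,
`Σ_{B ∈ 𝒜} demand(B) ≤ C(u,2) · #∂ᴵ_u(𝒜)`, modulo the base case. -/
theorem hallIndep2_of_base (hs : Simple' M) {u : ℕ} (hu : 3 ≤ u) (hbase : HallBase α u)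
    {𝒜 : Finset (Finset α)} (h𝒜 : 𝒜 ⊆ indepSets M 2) :
    ∑ B ∈ 𝒜, demand M 2 u B ≤ u.choose 2 * (indepShadow M u 𝒜).card :=
  hallIndep2_of_base_aux hu hbase (gr M).card M rfl hs 𝒜 h𝒜

/-! ### The fat half for families -/

/-- The pairs `(B, Y)` with `B` in a family of fat sets and `Y` an independent `(u−2)`-set of `M / B`. -/
noncomputable def fatPairsOf (M : Matroid α) [M.Finite] (u : ℕ) (𝒜 : Finset (Finset α)) :
    Finset (Σ _ : Finset α, Finset α) :=
  𝒜.sigma (fun B => indepSets (M ／ (B : Set α)) (u - 2))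

/-- `(B, Y) ↦ B ∪ Y` injects the pairs of a family of fat sets into its dependent shadow. -/
theorem card_fatPairsOf_le_card_fatShadow (hs : Simple' M) {u : ℕ} (hu : 2 ≤ u) {𝒜 : Finset (Finset α)}
    (h𝒜 : 𝒜 ⊆ fat2 M) : (fatPairsOf M u 𝒜).card ≤ (fatShadow M u 𝒜).card := by
  apply card_le_card_of_injOn (fun p : Σ _ : Finset α, Finset α => p.1 ∪ p.2)
  · intro p hp
    rw [Finset.mem_coe, fatPairsOf, mem_sigma] at hp
    rw [Finset.mem_coe, mem_fatShadow]
    exact ⟨(coloops_union_eq hs hu (h𝒜 hp.1) hp.2).1, p.1, hp.1, subset_union_left⟩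
  · intro p hp p' hp' hpp'
    rw [Finset.mem_coe, fatPairsOf, mem_sigma] at hp hp'
    have h1 := (coloops_union_eq hs hu (h𝒜 hp.1) hp.2).2
    have h2 := (coloops_union_eq hs hu (h𝒜 hp'.1) hp'.2).2
    simp only at hpp'
    have hY : p.2 = p'.2 := by rw [← h1, ← h2, hpp']
    have hB : p.1 = p'.1 := by
      have d1 : Disjoint p.1 p.2 :=
        (disjoint_of_subset_left (mem_indepSets.1 hp.2).1 (by rw [gr_contract_finset]; exact sdiff_disjoint)).symm
      have d2 : Disjoint p'.1 p'.2 :=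
        (disjoint_of_subset_left (mem_indepSets.1 hp'.2).1 (by rw [gr_contract_finset]; exact sdiff_disjoint)).symm
      have e1 : p.1 = (p.1 ∪ p.2) \ p.2 := (union_sdiff_cancel_right d1).symm
      have e2 : p'.1 = (p'.1 ∪ p'.2) \ p'.2 := (union_sdiff_cancel_right d2).symm
      rw [e1, e2, hpp', hY]
    exact Sigma.ext hB (heq_of_eq hY)

omit [DecidableEq α] in
/-- The number of pairs of a family is `Σ_{B ∈ 𝒜} I_{u−2}(M / B)`. -/
theorem card_fatPairsOf (u : ℕ) (𝒜 : Finset (Finset α)) :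
    (fatPairsOf M u 𝒜).card = ∑ B ∈ 𝒜, (indepSets (M ／ (B : Set α)) (u - 2)).card := by
  unfold fatPairsOf
  exact card_sigma _ _

/-- **The fat half for families (Theorem B per member)**: for every family `𝒜` of fat rank-`2` sets of a simple
matroid and `2 ≤ u ≤ ρ(E)`, `Σ_{B ∈ 𝒜} demand(B) ≤ C(u,2) · #(dependent shadow of 𝒜)`. -/
theorem hall_fat2 (hs : Simple' M) {u : ℕ} (hu : 2 ≤ u) (huR : u ≤ rk M (gr M)) {𝒜 : Finset (Finset α)}
    (h𝒜 : 𝒜 ⊆ fat2 M) :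
    ∑ B ∈ 𝒜, demand M 2 u B ≤ u.choose 2 * (fatShadow M u 𝒜).card := by
  have hterm : ∀ B ∈ 𝒜, demand M 2 u B ≤ u.choose 2 * (indepSets (M ／ (B : Set α)) (u - 2)).card := by
    intro B hB
    have hBf := h𝒜 hB
    have hBg : B ⊆ gr M := (mem_Rq.1 (mem_fat2.1 hBf).1).1
    have hrkB : rk M B = 2 := rk_eq_of_mem_Rq (mem_fat2.1 hBf).1
    have hrk := rk_gr_contract_add_rk hBg
    rw [hrkB] at hrk
    have hA := choose_rk_le_card_indepSets (M := M ／ (B : Set α)) (u - 2)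
    have hrk' : rk (M ／ (B : Set α)) (gr (M ／ (B : Set α))) = rk M (gr M) - 2 := by omega
    rw [hrk'] at hA
    have hdem : demand M 2 u B ≤ (rk M (gr M)).choose (u - 2) := by
      unfold demand
      split_ifs with h
      · apply Nat.choose_le_choose
        exact rk_mono' (M := M) (sdiff_subset : gr M \ B ⊆ gr M)
      · exact Nat.zero_le _
    calc demand M 2 u B ≤ (rk M (gr M)).choose (u - 2) := hdem
      _ ≤ u.choose 2 * (rk M (gr M) - 2).choose (u - 2) := choose_le_choose_two_mul_choose' hu huR
      _ ≤ u.choose 2 * (indepSets (M ／ (B : Set α)) (u - 2)).card := Nat.mul_le_mul_left _ hA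
  calc ∑ B ∈ 𝒜, demand M 2 u B
      ≤ ∑ B ∈ 𝒜, u.choose 2 * (indepSets (M ／ (B : Set α)) (u - 2)).card := sum_le_sum hterm
    _ = u.choose 2 * ∑ B ∈ 𝒜, (indepSets (M ／ (B : Set α)) (u - 2)).card := by rw [mul_sum]
    _ = u.choose 2 * (fatPairsOf M u 𝒜).card := by rw [card_fatPairsOf u 𝒜]
    _ ≤ u.choose 2 * (fatShadow M u 𝒜).card := Nat.mul_le_mul_left _ (card_fatPairsOf_le_card_fatShadow hs hu h𝒜)

/-! ### Assembly: `(H⁺_{2,u})` modulo the base -/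

/-- The independent shadow of the pairs of `𝒜` and the dependent shadow of its fat members lie in the shadow of `𝒜`,
disjointly. -/
theorem card_indepShadow_add_card_fatShadow_le (u : ℕ) (𝒜 : Finset (Finset α)) :
    (indepShadow M u (𝒜.filter (fun B => B ∈ indepSets M 2))).card +
      (fatShadow M u (𝒜.filter (fun B => B ∈ fat2 M))).card ≤ (shadowLevel M u 𝒜).card := by
  rw [← card_union_of_disjoint]
  · apply card_le_card
    intro S hS
    rw [mem_union, mem_indepShadow, mem_fatShadow] at hS
    rw [mem_shadowLevel, levelSet_eq_union u, mem_union]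
    rcases hS with ⟨hS, B, hB, hBS⟩ | ⟨hS, B, hB, hBS⟩
    · exact ⟨Or.inl hS, B, (mem_filter.1 hB).1, hBS⟩
    · exact ⟨Or.inr hS, B, (mem_filter.1 hB).1, hBS⟩
  · apply disjoint_of_subset_left (fun S hS => (mem_indepShadow.1 hS).1)
    apply disjoint_of_subset_right (fun S hS => (mem_fatShadow.1 hS).1)
    exact disjoint_indepSets_depU u

/-- A family of rank-`2` sets splits into its pairs and its fat members. -/
theorem sum_price_split (u : ℕ) {𝒜 : Finset (Finset α)} (h𝒜 : 𝒜 ⊆ Rq M 2) :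
    ∑ B ∈ 𝒜, price M 2 u B = ∑ B ∈ 𝒜.filter (fun B => B ∈ indepSets M 2), price M 2 u B +
      ∑ B ∈ 𝒜.filter (fun B => B ∈ fat2 M), price M 2 u B := by
  rw [← sum_filter_add_sum_filter_not 𝒜 (fun B => B ∈ indepSets M 2)]
  congr 1
  apply sum_congr _ (fun _ _ => rfl)
  ext B
  simp only [mem_filter]
  constructor
  · rintro ⟨hB, hnot⟩
    refine ⟨hB, ?_⟩
    have h := h𝒜 hB
    rw [Rq_two_eq_union, mem_union] at h
    exact h.resolve_left hnot
  · rintro ⟨hB, hfat⟩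
    exact ⟨hB, fun hI => disjoint_left.1 (disjoint_indepSets_fat2 (M := M)) hI hfat⟩

/-- `C(u,2) · Σ_{B ∈ 𝒜} price(B) = Σ_{B ∈ 𝒜} demand(B)` (as rationals). -/
theorem choose_mul_sum_price (u : ℕ) (hu : 2 ≤ u) (𝒜 : Finset (Finset α)) :
    (u.choose 2 : ℚ) * ∑ B ∈ 𝒜, price M 2 u B = ((∑ B ∈ 𝒜, demand M 2 u B : ℕ) : ℚ) := by
  rw [mul_sum, Nat.cast_sum]
  exact sum_congr rfl (fun B _ => choose_mul_price_eq_demand 2 u hu B)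

/-- **`(H⁺_{2,u})` on every simple matroid, every `u > 2`, modulo the base case `HallBase α u`.** -/
theorem hallIneq_two_of_simple_of_base (hs : Simple' M) {u : ℕ} (hu : 2 < u) (hbase : HallBase α u) :
    HallIneq M 2 u := by
  intro 𝒜 h𝒜
  rcases Nat.lt_or_ge (rk M (gr M)) u with hlt | huR
  · have hzero : ∀ B ∈ 𝒜, price M 2 u B = 0 := by
      intro B _
      unfold price
      rw [if_neg]
      intro h
      rw [← coe_rk] at h
      have h' : u ≤ rk M (gr M \ B) := by exact_mod_cast h
      have := rk_mono' (M := M) (sdiff_subset : gr M \ B ⊆ gr M)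
      omega
    rw [sum_eq_zero hzero]
    exact Nat.cast_nonneg _
  have hpos : (0 : ℚ) < (u.choose 2 : ℚ) := by exact_mod_cast Nat.choose_pos (by omega : 2 ≤ u)
  have hI : 𝒜.filter (fun B => B ∈ indepSets M 2) ⊆ indepSets M 2 := fun B hB => (mem_filter.1 hB).2
  have hF : 𝒜.filter (fun B => B ∈ fat2 M) ⊆ fat2 M := fun B hB => (mem_filter.1 hB).2
  have h1 := hallIndep2_of_base hs (by omega : 3 ≤ u) hbase hI
  have h2 := hall_fat2 hs (by omega : 2 ≤ u) huR hF
  have h3 := card_indepShadow_add_card_fatShadow_le (M := M) u 𝒜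
  have h1' : ∑ B ∈ 𝒜.filter (fun B => B ∈ indepSets M 2), price M 2 u B ≤
      ((indepShadow M u (𝒜.filter (fun B => B ∈ indepSets M 2))).card : ℚ) := by
    apply le_of_mul_le_mul_left _ hpos
    rw [choose_mul_sum_price u (by omega)]
    exact_mod_cast h1
  have h2' : ∑ B ∈ 𝒜.filter (fun B => B ∈ fat2 M), price M 2 u B ≤
      ((fatShadow M u (𝒜.filter (fun B => B ∈ fat2 M))).card : ℚ) := by
    apply le_of_mul_le_mul_left _ hpos
    rw [choose_mul_sum_price u (by omega)]
    exact_mod_cast h2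
  rw [sum_price_split u h𝒜]
  calc ∑ B ∈ 𝒜.filter (fun B => B ∈ indepSets M 2), price M 2 u B +
        ∑ B ∈ 𝒜.filter (fun B => B ∈ fat2 M), price M 2 u B
      ≤ ((indepShadow M u (𝒜.filter (fun B => B ∈ indepSets M 2))).card : ℚ) +
          ((fatShadow M u (𝒜.filter (fun B => B ∈ fat2 M))).card : ℚ) := add_le_add h1' h2'
    _ = (((indepShadow M u (𝒜.filter (fun B => B ∈ indepSets M 2))).card +
          (fatShadow M u (𝒜.filter (fun B => B ∈ fat2 M))).card : ℕ) : ℚ) := by push_cast; rfl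
    _ ≤ ((shadowLevel M u 𝒜).card : ℚ) := by exact_mod_cast h3

/-- **`(H⁺_{2,u})` for every finite matroid and every `u > 2`, modulo the base case `HallBase α u`** — night-3's
single-row reduction `hallIneq_row_of_simple` with the row `(1, u−1)` (`hallIneq_one_all`). -/
theorem hallIneq_two_all_of_base {u : ℕ} (hu : 2 < u) (hbase : HallBase α u) (M : Matroid α) [M.Finite] :
    HallIneq M 2 u := by
  obtain ⟨u', rfl⟩ : ∃ u', u = u' + 1 := ⟨u - 1, by omega⟩
  exact hallIneq_row_of_simple (q := 1) (u := u') (by omega)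
    (fun N _ hN => hallIneq_two_of_simple_of_base (simple'_of_set hN) hu hbase)
    (fun N _ => hallIneq_one_all N u' (by omega)) M

end PercRepro.Cogirth
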